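import Summits.Ventures.CertifiedArithmetic.LowPrec.SRRungR3
import Summits.Ventures.CertifiedArithmetic.LowPrec.SRTreeIntervalsExp
import HarnessLib

/-!
# Rung R3, any accumulation order: the summation-tree SR statements as venture Props, discharged

HONEST FRAMING: certified error envelopes and provably optimal rounding/accumulation schemes for
low-precision formats under stated cost models; every table by two implementations; no hardware or
vendor claims.

`SRRungR3.lean` states the recursive-summation (left-to-right) SR statements over the substrate
value set `MiniFloat.valueSet φ`.  This file does the same for summation in ANY ORDER — binary
summation trees `SR.STree` with a fresh stochastic rounding at every internal node (`SRTree*.lean`)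
— and inhabits each Prop by a landed theorem (no new mathematics here):

* `R3_SRTreeUnbiased φ`, `R3_SRTreeVariance φ` — absent saturation on every branch, `E ŝ_T = Σ xᵢ`
  for EVERY tree and the exact variance identity `E(ŝ_T − a)² = A_T + (Σ − a)²`;
* `R3_SRTreeEnvelope φ G` — `GapLET G ⇒ A_T ≤ m G²/4` (`m` = number of roundings, shape-free), and
  under `NoSatT` the sure bound `m G` and Chebyshev; `R3_SRTreeSpacing φ G` — `GapLET G` for every
  tree (E2M1 `2`, E3M2 `4`, E2M3 `1/2`, E4M3 `32`, E5M2-finite `8192`);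
* `R3_SRTreeExpTail φ G` — `P(|ŝ_T − Σ| ≥ t) ≤ 2·exp(−2t²/(m G²))`;
* `R3_SRTreeInterval φ` — the polynomial-cost interval certificates: `A_T ≤ envI(T)` with no
  hypothesis, `HullCert ⇒ NoSatT`, and under `NoSatT` the tails `envI/t²` and `2·exp(−t²/(2·envI))`.

That the ORDER changes the exact law and the saturation event in both directions is witnessed in the
kernel (`SR.Trees.order_witness_pairwise_better`, `order_witness_sequential_better`,
`saturation_order_witness_seq/bal`, SRTreeCertificates.lean); recursive summation is the left comb
(`SR.treeExp_comb`).
-/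

namespace Summit.Ventures.CertifiedArithmetic

open Literature.ComputerArithmetic.FloatingPoint
open Literature.ComputerArithmetic.FloatingPoint.MiniFloat
open Literature.ComputerArithmetic.FloatingPoint.Format
open Summit.Ventures.CertifiedArithmetic.LowPrec
open Finset

/-! ### Mean and exact variance, every order -/

/-- R3 (unbiasedness in any order): if no branch of the summation tree saturates, `E ŝ_T = Σ xᵢ`.
PROVED (sr seat): `LowPrec.SR.treeExp_id_of_noSatT` (SRTreeEnvelopes.lean; in general
`E ŝ_T = Σ xᵢ + treeBias`, `SR.treeExp_id`). -/
def R3_SRTreeUnbiased (φ : Format) : Prop :=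
  ∀ T : SR.STree ℚ, SR.NoSatT (valueSet φ) T → SR.treeExp (valueSet φ) T (fun v => v) = T.exact

/-- `R3_SRTreeUnbiased`: PROVED for every format. -/
theorem R3_SRTreeUnbiased_holds (φ : Format) : R3_SRTreeUnbiased φ :=
  fun T h => SR.treeExp_id_of_noSatT _ T h

/-- R3 (exact variance in any order): absent saturation, for every shift `a`,
`E(ŝ_T − a)² = A_T + (Σ xᵢ − a)²`, `A_T = SR.treeVar` the expected sum over the internal nodes of
the conditional one-step variances (subtrees independent, node errors martingale differences).
PROVED (sr seat): `LowPrec.SR.treeExp_sq_sub` (SRTreeEnvelopes.lean). -/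
def R3_SRTreeVariance (φ : Format) : Prop :=
  ∀ T : SR.STree ℚ, SR.NoSatT (valueSet φ) T → ∀ a : ℚ,
    SR.treeExp (valueSet φ) T (fun v => (v - a) ^ 2) = SR.treeVar (valueSet φ) T + (T.exact - a) ^ 2

/-- `R3_SRTreeVariance`: PROVED for every format. -/
theorem R3_SRTreeVariance_holds (φ : Format) : R3_SRTreeVariance φ :=
  fun T h a => SR.treeExp_sq_sub _ T h a

/-! ### Envelopes from a spacing bound, every order -/

/-- R3 (shape-free √m envelope): if every candidate gap met on every branch is `≤ G` then
`A_T ≤ m G²/4` with `m = T.nodes` the number of roundings (independent of the tree's shape); if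
moreover no branch saturates then surely `|ŝ_T − Σ| ≤ m G` and `P(|ŝ_T − Σ| ≥ t) ≤ m G²/(4t²)`.
PROVED (sr seat): `LowPrec.SR.treeVar_le`, `allOut_abs_sub_le`, `tree_prob_dev_ge_le`
(SRTreeEnvelopes.lean). -/
def R3_SRTreeEnvelope (φ : Format) (G : ℚ) : Prop :=
  ∀ T : SR.STree ℚ, SR.GapLET (valueSet φ) G T →
    SR.treeVar (valueSet φ) T ≤ T.nodes * G ^ 2 / 4 ∧
    (SR.NoSatT (valueSet φ) T →
      SR.AllOut (valueSet φ) T (fun v => |v - T.exact| ≤ T.nodes * G) ∧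
      ∀ t : ℚ, 0 < t →
        SR.treeExp (valueSet φ) T (SR.devInd t T.exact) ≤ T.nodes * G ^ 2 / (4 * t ^ 2))

/-- `R3_SRTreeEnvelope`: PROVED for every format and every `G`. -/
theorem R3_SRTreeEnvelope_holds (φ : Format) (G : ℚ) : R3_SRTreeEnvelope φ G :=
  fun T hg => ⟨SR.treeVar_le _ G T hg, fun h =>
    ⟨SR.allOut_abs_sub_le _ G T h hg, fun _ ht => SR.tree_prob_dev_ge_le _ G T h hg ht⟩⟩

/-- R3 (format spacing, trees): `G` bounds the candidate gap on EVERY branch of EVERY tree. -/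
def R3_SRTreeSpacing (φ : Format) (G : ℚ) : Prop :=
  ∀ T : SR.STree ℚ, SR.GapLET (valueSet φ) G T

/-- `R3_SRTreeSpacing`: PROVED with the top-binade spacings E2M1 `2`, E3M2 `4`, E2M3 `1/2`,
E4M3 `32`, E5M2 (finite part) `8192` (kernel successor certificates + literal = `valueSet`,
SRFormatsBridge.lean). -/
theorem R3_SRTreeSpacing_formats :
    R3_SRTreeSpacing E2M1 2 ∧ R3_SRTreeSpacing E3M2 4 ∧ R3_SRTreeSpacing E2M3 (1 / 2) ∧
    R3_SRTreeSpacing E4M3 32 ∧ R3_SRTreeSpacing E5M2 8192 := by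
  refine ⟨fun T => ?_, fun T => ?_, fun T => ?_, fun T => ?_, fun T => ?_⟩
  · rw [← SR.e2m1_eq_valueSet]
    exact SR.gapLET_of_succ SR.FP4.e2m1_nonempty (G := 2) (by norm_num) SR.FP4.e2m1_succ T
  · rw [← SR.e3m2_eq_valueSet]
    exact SR.gapLET_of_succ SR.Formats.e3m2_nonempty (G := 4) (by norm_num) SR.Formats.e3m2_succ T
  · rw [← SR.e2m3_eq_valueSet]
    exact SR.gapLET_of_succ SR.Formats.e2m3_nonempty (G := 1 / 2) (by norm_num)
      SR.Formats.e2m3_succ T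
  · rw [← SR.e4m3_eq_valueSet]
    exact SR.gapLET_of_succ SR.Formats.e4m3_nonempty (G := 32) (by norm_num) SR.Formats.e4m3_succ T
  · rw [← SR.e5m2_eq_valueSet]
    exact SR.gapLET_of_succ SR.Formats.e5m2_nonempty (G := 8192) (by norm_num)
      SR.Formats.e5m2_succ T

/-! ### Exponential tail, every order -/

/-- R3 (martingale concentration, any order): under `NoSatT ∧ GapLET G`, for every `t > 0`,
`P(|ŝ_T − Σ| ≥ t) ≤ 2·exp(−2t²/(m G²))` (the rational probability cast to `ℝ`).
PROVED (sr seat): `LowPrec.SR.tree_prob_dev_ge_le_exp_rat` (SRTreeHoeffding.lean). -/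
def R3_SRTreeExpTail (φ : Format) (G : ℚ) : Prop :=
  ∀ T : SR.STree ℚ, SR.NoSatT (valueSet φ) T → SR.GapLET (valueSet φ) G T → ∀ t : ℚ, 0 < t →
    ((SR.treeExp (valueSet φ) T (SR.devInd t T.exact) : ℚ) : ℝ)
      ≤ 2 * Real.exp (-2 * (t : ℝ) ^ 2 / (T.nodes * (G : ℝ) ^ 2))

/-- `R3_SRTreeExpTail`: PROVED for every format and every `G`. -/
theorem R3_SRTreeExpTail_holds (φ : Format) (G : ℚ) : R3_SRTreeExpTail φ G :=
  fun T h hg t ht => SR.tree_prob_dev_ge_le_exp_rat _ G T h hg t ht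

/-- Combining with `R3_SRTreeSpacing`: on a format of spacing `≤ G` the tail needs only `NoSatT`. -/
theorem R3_SRTreeExpTail_of_spacing {φ : Format} {G : ℚ} (hsp : R3_SRTreeSpacing φ G)
    (T : SR.STree ℚ) (h : SR.NoSatT (valueSet φ) T) (t : ℚ) (ht : 0 < t) :
    ((SR.treeExp (valueSet φ) T (SR.devInd t T.exact) : ℚ) : ℝ)
      ≤ 2 * Real.exp (-2 * (t : ℝ) ^ 2 / (T.nodes * (G : ℝ) ^ 2)) :=
  R3_SRTreeExpTail_holds φ G T h (hsp T) t ht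

/-! ### Interval certificates (polynomial cost) -/

/-- R3 (interval certificates): for a nonempty value set and EVERY tree, with `envI(T)` the sum over
the internal nodes of (local spacing of the node's certified window)²/4 — computable in
`O(m·|F|²)` — `A_T ≤ envI(T)` with NO hypothesis; the `O(m)` hull certificate implies `NoSatT`; and
under `NoSatT`,
`P(|ŝ_T − Σ| ≥ t) ≤ envI(T)/t²` and `≤ 2·exp(−t²/(2·envI(T)))`.
PROVED (sr seat): `LowPrec.SR.treeVar_le_envI`, `noSatT_of_hullCert`, `tree_prob_dev_ge_le_envI`
(SRTreeIntervals.lean), `tree_prob_dev_ge_le_exp_I_rat` (SRTreeIntervalsExp.lean). -/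
def R3_SRTreeInterval (φ : Format) : Prop :=
  (valueSet φ).Nonempty → ∀ T : SR.STree ℚ,
    SR.treeVar (valueSet φ) T ≤ SR.envI (valueSet φ) T ∧
    (SR.HullCert (valueSet φ) T → SR.NoSatT (valueSet φ) T) ∧
    (SR.NoSatT (valueSet φ) T → ∀ t : ℚ, 0 < t →
      SR.treeExp (valueSet φ) T (SR.devInd t T.exact) ≤ SR.envI (valueSet φ) T / t ^ 2 ∧
      ((SR.treeExp (valueSet φ) T (SR.devInd t T.exact) : ℚ) : ℝ)
        ≤ 2 * Real.exp (-(t : ℝ) ^ 2 / (2 * ((SR.envI (valueSet φ) T : ℚ) : ℝ))))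

/-- `R3_SRTreeInterval`: PROVED for every format. -/
theorem R3_SRTreeInterval_holds (φ : Format) : R3_SRTreeInterval φ :=
  fun hF T => ⟨SR.treeVar_le_envI hF T, SR.noSatT_of_hullCert hF T, fun h t ht =>
    ⟨SR.tree_prob_dev_ge_le_envI hF T h ht, SR.tree_prob_dev_ge_le_exp_I_rat hF T h t ht⟩⟩

/-- The value sets of the five formats are nonempty (so `R3_SRTreeInterval` applies outright). -/
theorem valueSet_nonempty_formats :
    (valueSet E2M1).Nonempty ∧ (valueSet E3M2).Nonempty ∧ (valueSet E2M3).Nonempty ∧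
    (valueSet E4M3).Nonempty ∧ (valueSet E5M2).Nonempty := by
  refine ⟨?_, ?_, ?_, ?_, ?_⟩
  · rw [← SR.e2m1_eq_valueSet]; exact SR.FP4.e2m1_nonempty
  · rw [← SR.e3m2_eq_valueSet]; exact SR.Formats.e3m2_nonempty
  · rw [← SR.e2m3_eq_valueSet]; exact SR.Formats.e2m3_nonempty
  · rw [← SR.e4m3_eq_valueSet]; exact SR.Formats.e4m3_nonempty
  · rw [← SR.e5m2_eq_valueSet]; exact SR.Formats.e5m2_nonempty

end Summit.Ventures.CertifiedArithmetic
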